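import Summits.NavierStokesRegularity.FluidComputer.PalasekTowerMatchedGerm

/-!
# The germ of an EVEN, FLAT profile: the NS acceleration vanishes at the centre

Cell `ns-blowup`, seat `ns-blowup-ecbridge-4` (g3); GROUP C «BRIDGE SUPPORT» of the route
`PalasekTowerBreakdown` (crux `EpisodeBaseG`, item stmt-NavierStokesRegularity-19179). Companion of
ecbridge-3's `PalasekTowerMatchedGerm.lean` (`drift`, `pot`, `accel`) and of this seat's
`PalasekTowerGermPushedAnchor.lean` / `PalasekTowerGermHostPushed.lean` (the weak slot
`LevelZeroDataWeak`: anchor test `0 ≤ ⟪U, accel 1 U⟫` on the argmax). LABEL: E–C typing (KERNEL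
calculus: parity bookkeeping for the Newtonian pressure potential; everything proved, no definitions).
WHAT THIS IS NOT: not Navier–Stokes evidence — no flow, stage or schedule is built here.

## The point

The weak anchor test of the pushed germ host asks `⟪U(x₀), V(x₀)⟫ ≥ 0` at every argmax `x₀` of `‖U‖`,
`V = accel ν U = νΔU − (U·∇)U − ∇π`, `π = Δ⁻¹ div(νΔU − (U·∇)U)` (ecbridge-3's `pot`). For the tiny blobs
of the negative lane (`TinyAnchoredHosts`) the argmax is the centre `0` of an EVEN profile
(`U(−y) = U(y)`) which is FLAT there (`DU(0) = 0`, `ΔU(0) = 0`). Then `V(0) = 0` exactly: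
`(U·∇)U (0) = DU(0) U(0) = 0`; `div ΔU = 0` (`divergence_laplacian_eq_zero`), `(U·∇)U` is ODD, so the
source `div(νΔU − (U·∇)U)` of the potential is EVEN, the Newtonian kernel is even, hence `π` is even and
`∇π(0) = 0`. So the weak test holds (with equality) and the PUSH of the register alone carries the anchor.

* `fderiv_neg_of_even`, `convect_self_odd_of_even`, `divergence_even_of_odd` — parity calculus;
* `divPotential_even_of_even` — the Newtonian potential of an even compactly supported smooth field's
  divergence … (stated for an even SOURCE: `divergence G` even ⇒ `π[G]` even);
* `gradient_eq_zero_of_even` — an even differentiable function has zero gradient at `0`;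
* **`accel_eq_zero_of_even_flat`** — `U` smooth, compactly supported, divergence free, even,
  `DU(0) = 0`, `ΔU(0) = 0` ⇒ `accel ν U 0 = 0`.

References: A. J. Majda, A. L. Bertozzi, *Vorticity and Incompressible Flow* (CUP 2002), §1.8 Prop. 1.16
(Hodge decomposition) [cite: MajdaBertozziCUP2002, §1.8 Prop. 1.16]; D. Gilbarg, N. S. Trudinger,
*Elliptic PDE of second order* (2001), (2.17) [cite: GilbargTrudinger2001, (2.17)].
-/

noncomputable section

namespace Summit.NavierStokesRegularity.FluidComputer.PalasekTowerClayBridge.Germ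

open Set Function Filter Topology InnerProductSpace Metric MeasureTheory
open scoped Topology ContDiff RealInnerProductSpace Laplacian

open Literature.Analysis.FluidPDE

variable {ν : ℝ} {U : EuclideanSpace ℝ (Fin 3) → EuclideanSpace ℝ (Fin 3)}

/-! ## §1 Parity calculus -/

section Parity

variable {F : Type*} [NormedAddCommGroup F] [NormedSpace ℝ F]

/-- For an EVEN differentiable map (`W(−y) = W(y)`): `DW(−x) h = −DW(x) h`. [folklore] -/
theorem fderiv_apply_neg_of_even {W : EuclideanSpace ℝ (Fin 3) → F} (hW : Differentiable ℝ W)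
    (heven : ∀ y, W (-y) = W y) (x h : EuclideanSpace ℝ (Fin 3)) :
    fderiv ℝ W (-x) h = -(fderiv ℝ W x h) := by
  have hcomp : (fun y => W (-y)) = W := funext heven
  have hd₁ : HasFDerivAt (fun y => W (-y)) ((fderiv ℝ W (-x)).comp (-ContinuousLinearMap.id ℝ _)) x :=
    (hW (-x)).hasFDerivAt.comp x (hasFDerivAt_id x).neg
  have hd₂ : HasFDerivAt (fun y => W (-y)) (fderiv ℝ W x) x := by
    rw [hcomp]; exact (hW x).hasFDerivAt
  have h := congrArg (fun L : EuclideanSpace ℝ (Fin 3) →L[ℝ] F => L (-h)) (hd₁.unique hd₂)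
  simp only [ContinuousLinearMap.coe_comp, comp_apply, neg_apply,
    ContinuousLinearMap.coe_id', id_eq, neg_neg, map_neg] at h
  exact h

/-- For an ODD differentiable map (`W(−y) = −W(y)`): `DW(−x) h = DW(x) h`. [folklore] -/
theorem fderiv_apply_neg_of_odd {W : EuclideanSpace ℝ (Fin 3) → F} (hW : Differentiable ℝ W)
    (hodd : ∀ y, W (-y) = -W y) (x h : EuclideanSpace ℝ (Fin 3)) :
    fderiv ℝ W (-x) h = fderiv ℝ W x h := by
  have hcomp : (fun y => W (-y)) = fun y => -W y := funext hodd
  have hd₁ : HasFDerivAt (fun y => W (-y)) ((fderiv ℝ W (-x)).comp (-ContinuousLinearMap.id ℝ _)) x :=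
    (hW (-x)).hasFDerivAt.comp x (hasFDerivAt_id x).neg
  have hd₂ : HasFDerivAt (fun y => W (-y)) (-fderiv ℝ W x) x := by
    rw [hcomp]; exact (hW x).hasFDerivAt.neg
  have h := congrArg (fun L : EuclideanSpace ℝ (Fin 3) →L[ℝ] F => L (-h)) (hd₁.unique hd₂)
  simp only [ContinuousLinearMap.coe_comp, comp_apply, neg_apply,
    ContinuousLinearMap.coe_id', id_eq, neg_neg, map_neg] at h
  exact h

/-- `(U·∇)U` is ODD for an even differentiable `U`. [folklore] -/
theorem convect_self_neg_of_even (hU : Differentiable ℝ U) (heven : ∀ y, U (-y) = U y)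
    (x : EuclideanSpace ℝ (Fin 3)) : convect U U (-x) = -convect U U x := by
  rw [convect_apply, convect_apply, heven, fderiv_apply_neg_of_even hU heven]

/-- The divergence of an ODD differentiable field is EVEN. [folklore] -/
theorem divergence_neg_of_odd {W : EuclideanSpace ℝ (Fin 3) → EuclideanSpace ℝ (Fin 3)}
    (hW : Differentiable ℝ W) (hodd : ∀ y, W (-y) = -W y) (x : EuclideanSpace ℝ (Fin 3)) :
    VectorCalculus.divergence W (-x) = VectorCalculus.divergence W x := by
  have h : fderiv ℝ W (-x) = fderiv ℝ W x :=
    ContinuousLinearMap.ext fun h => fderiv_apply_neg_of_odd hW hodd x h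
  simp only [VectorCalculus.divergence, h]

/-- An even differentiable real function has zero gradient at the origin. [folklore] -/
theorem gradient_zero_eq_zero_of_even {p : EuclideanSpace ℝ (Fin 3) → ℝ} (hp : Differentiable ℝ p)
    (heven : ∀ y, p (-y) = p y) : gradient p 0 = 0 := by
  have h : ∀ h : EuclideanSpace ℝ (Fin 3), fderiv ℝ p 0 h = 0 := by
    intro h
    have := fderiv_apply_neg_of_even hp heven 0 h
    rw [neg_zero] at this
    linarith
  have hf : fderiv ℝ p 0 = 0 := ContinuousLinearMap.ext h
  rw [gradient, hf, map_zero]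

end Parity

/-! ## §2 The Newtonian potential of an even source is even -/

/-- The Newtonian potential `π[G] = (div G) ⋆ Γ` is EVEN whenever the source `div G` is even
(`Γ(−z) = Γ(z)` and Lebesgue measure is invariant under `t ↦ −t`). [cite: GilbargTrudinger2001, (2.17)] -/
theorem divPotential_neg_of_divergence_even {G : EuclideanSpace ℝ (Fin 3) → EuclideanSpace ℝ (Fin 3)}
    (heven : ∀ y, VectorCalculus.divergence G (-y) = VectorCalculus.divergence G y)
    (x : EuclideanSpace ℝ (Fin 3)) : divPotential G (-x) = divPotential G x := by
  rw [divPotential_apply, divPotential_apply,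
    ← integral_neg_eq_self (fun t => newtonKernel (x - t) * VectorCalculus.divergence G t) volume]
  -- `∫ Γ(−x − t) s(t) dt = ∫ Γ(x + t) s(−t) dt`, pointwise: `Γ` and `s` are even
  refine integral_congr_ae (Eventually.of_forall fun t => ?_)
  simp only
  rw [heven t, show -x - t = -(x - -t) by abel, newtonKernel_neg]

/-! ## §3 The acceleration of an even flat profile vanishes at the centre -/

variable (hU : ContDiff ℝ ∞ U) (hUc : HasCompactSupport U)
include hU hUc

omit hUc in
/-- The source of the germ's pressure potential is `div(νΔU − (U·∇)U) = −div((U·∇)U)` for a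
divergence-free profile (`div ΔU = Δ div U = 0`). [folklore] -/
theorem divergence_drift (hdiv : VectorCalculus.IsDivFree U) (x : EuclideanSpace ℝ (Fin 3)) :
    VectorCalculus.divergence (drift ν U) x = -VectorCalculus.divergence (convect U U) x := by
  have hU3 : ContDiff ℝ 3 U := hU.of_le (by norm_cast)
  have hΔ : Differentiable ℝ (Δ U) :=
    (contDiff_laplacian (n := 1) (hU.of_le (by norm_cast))).differentiable (by simp)
  have hΔ' : DifferentiableAt ℝ (fun y => ν • (Δ U) y) x := (hΔ x).const_smul ν
  have hC : DifferentiableAt ℝ (convect U U) x :=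
    ((contDiff_convect_self hU).differentiable (by simp)) x
  have h0 : VectorCalculus.divergence (Δ U) x = 0 := divergence_laplacian_eq_zero hU3 hdiv x
  have h1 : VectorCalculus.divergence (fun y => ν • (Δ U) y) x = ν * VectorCalculus.divergence (Δ U) x := by
    simp only [VectorCalculus.divergence]
    rw [fderiv_fun_const_smul (hΔ x)]
    simp
  show VectorCalculus.divergence (fun y => ν • (Δ U) y - convect U U y) x = _
  rw [divergence_sub_apply hΔ' hC, h1, h0, mul_zero, zero_sub]

/-- **THE NS ACCELERATION OF AN EVEN FLAT PROFILE VANISHES AT THE CENTRE.** If `U` is smooth,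
compactly supported, divergence free, EVEN (`U(−y) = U(y)`), and flat at the origin (`DU(0) = 0`,
`ΔU(0) = 0`), then `accel ν U 0 = 0`: the drift `νΔU − (U·∇)U` vanishes at `0`, and the pressure
potential `π = Δ⁻¹ div(drift)` — whose source `−div((U·∇)U)` is even — is even, so `∇π(0) = 0`.
Consequently the weak anchor test `0 ≤ ⟪U(0), accel ν U 0⟫` holds at the centre.
[cite: MajdaBertozziCUP2002, §1.8 Prop. 1.16] -/
theorem accel_eq_zero_of_even_flat (hdiv : VectorCalculus.IsDivFree U) (heven : ∀ y, U (-y) = U y)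
    (hD : fderiv ℝ U 0 = 0) (hΔ0 : (Δ U) 0 = 0) : accel ν U 0 = 0 := by
  have hUd : Differentiable ℝ U := hU.differentiable (by simp)
  -- the drift vanishes at the centre
  have hdrift : drift ν U 0 = 0 := by
    show ν • (Δ U) 0 - convect U U 0 = 0
    rw [hΔ0, smul_zero, convect_apply, hD, zero_apply, sub_zero]
  -- the source of the potential is even
  have hCd : Differentiable ℝ (convect U U) := (contDiff_convect_self hU).differentiable (by simp)
  have hsrc : ∀ y, VectorCalculus.divergence (drift ν U) (-y) = VectorCalculus.divergence (drift ν U) y := by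
    intro y
    rw [divergence_drift hU hdiv, divergence_drift hU hdiv,
      divergence_neg_of_odd hCd (convect_self_neg_of_even hUd heven)]
  -- hence the potential is even and its gradient vanishes at the centre
  have hpot : ∀ y, pot ν U (-y) = pot ν U y := fun y => divPotential_neg_of_divergence_even hsrc y
  have hpd : Differentiable ℝ (pot ν U) := (contDiff_pot hU hUc ν).differentiable (by simp)
  rw [accel_apply ν 0, hdrift, gradient_zero_eq_zero_of_even hpd hpot, sub_zero]

/-- **The weak anchor test at the centre of an even flat profile.** [folklore] -/
theorem inner_accel_nonneg_of_even_flat (hdiv : VectorCalculus.IsDivFree U) (heven : ∀ y, U (-y) = U y)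
    (hD : fderiv ℝ U 0 = 0) (hΔ0 : (Δ U) 0 = 0) : 0 ≤ ⟪U 0, accel ν U 0⟫ := by
  rw [accel_eq_zero_of_even_flat hU hUc hdiv heven hD hΔ0, inner_zero_right]

end Summit.NavierStokesRegularity.FluidComputer.PalasekTowerClayBridge.Germ

end
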